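/-
Copyright (c) 2026 the pub-hodgecm-mathlib formalisation cell (harness21).  Prover seat hodgecm-mathlib-LH4-p09 (g8), req620 Track A «(D-RAM) FOUR-FRAME» squad
(heir dealer LH4-plan (g13) WORD #74 (2) ∕ #83: (d) cells, PART 3a — the rotated tokens).  2026-09-04.
-/
import Summits.HodgeConjecture.HodgeConjecture.Theorems.F0P3cDyRamSqTokenReadLetter                    -- ★ p860043 (this seat): valuation toolkit; brings `ne_zero_and_v_lt_one_of_v_eq_exp`
import HarnessLib

/-!
# (D-RAM) four-frame, STAGE 1b — (d) CELLS, PART 3a: the `(0 2)`-ROTATED TOKENS `E₁ = (0, x, y)`, `E₂ = (0, x², y²)` — valuation data, glue ratios, and the disjointness of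
# the two witness balls around `−g` and `−g(2−g)`

Helper brick for dealer LH4-plan (g13) WORD #74 (2) ∕ #83 ((d) = the CELLS of the lev box-sum, this seat; the assembly is LH4-p12 (g7)'s): `Theorems/` only, statement-first,
★-only imports, lane `--supports stmt-HodgeConjecture-24833 --as helper`; PAYS NO tier-0 row (count-neutral).  The swap `(0 2)` + unit rescaling (★ T3) turns the G3 cell of
`(α, β; n₁, n₂, n₃)` with tokens `(D₁, D₂)` into a G1 cell of `(a, b) = (α⁻¹, βα⁻¹)` with depths `(n₃, n₂, n₁)` and tokens `E₁ = (0, x, y)`, `E₂ = (0, x², y²)`, `x = u(b−a)`,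
`y = u(1−a)`, `|u| = 1`.  `E₁` behaves like the model token of `(a,b)` (`|y| = |ϖ|^{n₂}`, `|y−x| = |ϖ|^{n₁}`, glue ratio `(y−x)∕y = (b−1)∕(a−1) = g`); `E₂` does NOT
(`|y²−x²| = |ϖ|^{n₁}·|y+x|`, possible cancellation; glue ratio `g(2−g)`, not `g²`).  PART 3b (`…LevLabelledCellsGluedThree`) evaluates the cell.
* `rotTokens_data`, `glueRatio_rotToken₁_eq`, `glueRatio_rotToken₂_eq`, `not_exists_common_witness_rot`.

HONEST LABEL: helper organs for the cells of HYPOTHESES (the four lev trunk letters); STAGE-1b tier-0 rows and the ED. 5∕6 law stubs stay OPEN; HC_CM is proved only modulo the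
7 printed citations (2 remaining named inputs: hLiu418 = `stmt-HodgeConjecture-24832`, h413 = `stmt-HodgeConjecture-24833`) until rung 0 closes.

## References
* [Rogawski1990] J. D. Rogawski, *Automorphic Representations of Unitary Groups in Three Variables*, Ann. of Math. Stud. 123 (1990), §4.9 Prop. 4.9.1 (a)(b) p. 55 (root depths).
* [Serre1979] J.-P. Serre, *Local Fields*, GTM 67 (1979), Ch. V §3 Prop. 5, Cor. 3 (norm residue symbol; glue-unit rationality depth).
-/

set_option autoImplicit false

noncomputable section

namespace Summit.HodgeConjecture.HodgeConjecture.Cruxes.H413.F0P3cDyRamLevLabelledRotTokens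

open Matrix WithZero
open Literature.NumberTheory.Automorphic Literature.NumberTheory.Automorphic.HermitianLattice
open Literature.NumberTheory.Automorphic.UnitaryLatticeTree Literature.NumberTheory.Automorphic.UnitaryThreeFourFrame
open Summit.HodgeConjecture.HodgeConjecture.Cruxes.H413.F0P3cDyRamDiagonalGluedStabiliserIndex (ne_zero_and_v_lt_one_of_v_eq_exp)
open scoped Valued WithZero Matrix MatrixGroups

/-! ## §1  The rotated tokens `E₁ = (0, x, y)`, `E₂ = (0, x², y²)` -/

section Data

variable {K : Type*} [Field K] [Valued K ℤᵐ⁰]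

/-- **VALUATION DATA OF THE ROTATED TOKENS** (`x = u(b−a)`, `y = u(1−a)`, `|u| = 1`; datum `|b−1| = |ϖ|^{n₁}`, `|a−1| = |ϖ|^{n₂}`, `|a−b| = |ϖ|^{n₃}`):
`|E₁2 − E₁0| = |y| = |ϖ|^{n₂}`, `|E₁2 − E₁1| = |y−x| = |ϖ|^{n₁}`, `|E₁1 − E₁0| = |E₁1| = |ϖ|^{n₃}`, `E₁0 = 0`, `|E₁2| = |ϖ|^{n₂}`; `|E₂2 − E₂0| = |ϖ|^{2n₂}`, `|E₂1| = |E₂1 − E₂0| = |ϖ|^{2n₃}`,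
`E₂0 = 0`, `|E₂2| = |ϖ|^{2n₂}`, `|E₂2 − E₂1| ≤ |ϖ|^{n₁ + min(n₂,n₃)}`. [cite: Rogawski1990, §4.9 Prop. 4.9.1 (a) p. 55] -/
theorem rotTokens_data {ϖ a b u : K} (hϖ1 : Valued.v ϖ ≤ 1) (hu : Valued.v u = 1) {n₁ n₂ n₃ : ℕ} (h₁ : Valued.v (b - 1) = Valued.v ϖ ^ n₁)
    (h₂ : Valued.v (a - 1) = Valued.v ϖ ^ n₂) (h₃ : Valued.v (a - b) = Valued.v ϖ ^ n₃) :
    Valued.v ((![0, u * (b - a), u * (1 - a)] : Fin 3 → K) 2 - (![0, u * (b - a), u * (1 - a)] : Fin 3 → K) 0) = Valued.v ϖ ^ n₂ ∧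
    Valued.v ((![0, u * (b - a), u * (1 - a)] : Fin 3 → K) 2 - (![0, u * (b - a), u * (1 - a)] : Fin 3 → K) 1) = Valued.v ϖ ^ n₁ ∧
    Valued.v ((![0, u * (b - a), u * (1 - a)] : Fin 3 → K) 1 - (![0, u * (b - a), u * (1 - a)] : Fin 3 → K) 0) = Valued.v ϖ ^ n₃ ∧
    (Valued.v ((![0, u * (b - a), u * (1 - a)] : Fin 3 → K) 0) = 0 ∧ Valued.v ((![0, u * (b - a), u * (1 - a)] : Fin 3 → K) 1) = Valued.v ϖ ^ n₃ ∧
      Valued.v ((![0, u * (b - a), u * (1 - a)] : Fin 3 → K) 2) = Valued.v ϖ ^ n₂) ∧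
    Valued.v ((![0, (u * (b - a)) * (u * (b - a)), (u * (1 - a)) * (u * (1 - a))] : Fin 3 → K) 2 -
        (![0, (u * (b - a)) * (u * (b - a)), (u * (1 - a)) * (u * (1 - a))] : Fin 3 → K) 0) = Valued.v ϖ ^ (2 * n₂) ∧
    Valued.v ((![0, (u * (b - a)) * (u * (b - a)), (u * (1 - a)) * (u * (1 - a))] : Fin 3 → K) 1 -
        (![0, (u * (b - a)) * (u * (b - a)), (u * (1 - a)) * (u * (1 - a))] : Fin 3 → K) 0) = Valued.v ϖ ^ (2 * n₃) ∧
    (Valued.v ((![0, (u * (b - a)) * (u * (b - a)), (u * (1 - a)) * (u * (1 - a))] : Fin 3 → K) 0) = 0 ∧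
      Valued.v ((![0, (u * (b - a)) * (u * (b - a)), (u * (1 - a)) * (u * (1 - a))] : Fin 3 → K) 1) = Valued.v ϖ ^ (2 * n₃) ∧
      Valued.v ((![0, (u * (b - a)) * (u * (b - a)), (u * (1 - a)) * (u * (1 - a))] : Fin 3 → K) 2) = Valued.v ϖ ^ (2 * n₂)) ∧
    Valued.v ((![0, (u * (b - a)) * (u * (b - a)), (u * (1 - a)) * (u * (1 - a))] : Fin 3 → K) 2 -
        (![0, (u * (b - a)) * (u * (b - a)), (u * (1 - a)) * (u * (1 - a))] : Fin 3 → K) 1) ≤ Valued.v ϖ ^ (n₁ + min n₂ n₃) := by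
  have hba : Valued.v (b - a) = Valued.v ϖ ^ n₃ := by rw [Valuation.map_sub_swap, h₃]
  have h1a : Valued.v (1 - a) = Valued.v ϖ ^ n₂ := by rw [Valuation.map_sub_swap, h₂]
  have hx : Valued.v (u * (b - a)) = Valued.v ϖ ^ n₃ := by rw [map_mul, hu, one_mul, hba]
  have hy : Valued.v (u * (1 - a)) = Valued.v ϖ ^ n₂ := by rw [map_mul, hu, one_mul, h1a]
  have hyx : Valued.v (u * (1 - a) - u * (b - a)) = Valued.v ϖ ^ n₁ := by
    rw [show u * (1 - a) - u * (b - a) = u * (1 - b) by ring, map_mul, hu, one_mul, Valuation.map_sub_swap, h₁]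
  have hsum : Valued.v (u * (1 - a) + u * (b - a)) ≤ Valued.v ϖ ^ min n₂ n₃ := by
    refine Valuation.map_add_le _ ?_ ?_
    · rw [hy]; exact pow_le_pow_right_of_le_one' hϖ1 (min_le_left _ _)
    · rw [hx]; exact pow_le_pow_right_of_le_one' hϖ1 (min_le_right _ _)
  simp only [Matrix.cons_val_zero, Matrix.cons_val_one, Matrix.cons_val_two, Matrix.tail_cons, Matrix.head_cons, sub_zero, map_zero]
  refine ⟨hy, hyx, hx, ⟨trivial, hx, hy⟩, ?_, ?_, ⟨trivial, ?_, ?_⟩, ?_⟩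
  · rw [map_mul, hy, ← pow_add, two_mul]
  · rw [map_mul, hx, ← pow_add, two_mul]
  · rw [map_mul, hx, ← pow_add, two_mul]
  · rw [map_mul, hy, ← pow_add, two_mul]
  · rw [show u * (1 - a) * (u * (1 - a)) - u * (b - a) * (u * (b - a)) = (u * (1 - a) - u * (b - a)) * (u * (1 - a) + u * (b - a)) by ring, map_mul, hyx,
      pow_add]
    exact mul_le_mul' le_rfl hsum

omit [Valued K ℤᵐ⁰] in
/-- Glue ratio of `E₁`: `(E₁2 − E₁1)∕(E₁2 − E₁0) = (y−x)∕y = (b−1)∕(a−1)`. [cite: Rogawski1990, §4.9 Prop. 4.9.1 (a) p. 55] -/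
theorem glueRatio_rotToken₁_eq {a b u : K} (hu : u ≠ 0) (ha : a ≠ 1) :
    ((![0, u * (b - a), u * (1 - a)] : Fin 3 → K) 2 - (![0, u * (b - a), u * (1 - a)] : Fin 3 → K) 1) /
        ((![0, u * (b - a), u * (1 - a)] : Fin 3 → K) 2 - (![0, u * (b - a), u * (1 - a)] : Fin 3 → K) 0) = (b - 1) / (a - 1) := by
  have ha' : a - 1 ≠ 0 := sub_ne_zero.2 ha
  have ha'' : 1 - a ≠ 0 := sub_ne_zero.2 (Ne.symm ha)
  simp only [Matrix.cons_val_zero, Matrix.cons_val_one, Matrix.cons_val_two, Matrix.tail_cons, Matrix.head_cons, sub_zero]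
  rw [div_eq_div_iff (mul_ne_zero hu ha'') ha']
  ring

omit [Valued K ℤᵐ⁰] in
/-- Glue ratio of `E₂`: `(E₂2 − E₂1)∕(E₂2 − E₂0) = (y²−x²)∕y² = g(2−g)`, `g = (b−1)∕(a−1)`. [cite: Rogawski1990, §4.9 Prop. 4.9.1 (a) p. 55] -/
theorem glueRatio_rotToken₂_eq {a b u : K} (hu : u ≠ 0) (ha : a ≠ 1) :
    ((![0, (u * (b - a)) * (u * (b - a)), (u * (1 - a)) * (u * (1 - a))] : Fin 3 → K) 2 -
          (![0, (u * (b - a)) * (u * (b - a)), (u * (1 - a)) * (u * (1 - a))] : Fin 3 → K) 1) /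
        ((![0, (u * (b - a)) * (u * (b - a)), (u * (1 - a)) * (u * (1 - a))] : Fin 3 → K) 2 -
          (![0, (u * (b - a)) * (u * (b - a)), (u * (1 - a)) * (u * (1 - a))] : Fin 3 → K) 0) =
      (b - 1) / (a - 1) * (2 - (b - 1) / (a - 1)) := by
  have ha' : a - 1 ≠ 0 := sub_ne_zero.2 ha
  have ha'' : 1 - a ≠ 0 := sub_ne_zero.2 (Ne.symm ha)
  simp only [Matrix.cons_val_zero, Matrix.cons_val_one, Matrix.cons_val_two, Matrix.tail_cons, Matrix.head_cons, sub_zero]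
  rw [show (b - 1) / (a - 1) * (2 - (b - 1) / (a - 1)) = ((b - 1) * (2 * (a - 1) - (b - 1))) / ((a - 1) * (a - 1)) by
    field_simp]
  rw [div_eq_div_iff (mul_ne_zero (mul_ne_zero hu ha'') (mul_ne_zero hu ha'')) (mul_ne_zero ha' ha')]
  ring

/-- **TWO WITNESS BALLS AROUND `−g` AND `−g(2−g)` WITH `|g| = |ϖ|^m`, `m ≥ 1`, AND BOTH EXPONENTS `> m` DO NOT MEET** (`|g − g(2−g)| = |g|·|g−1| = |ϖ|^m`).
[cite: Serre1979, Ch. V §3 Prop. 5, Cor. 3] -/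
theorem not_exists_common_witness_rot {ϖ g : K} (hϖ : Valued.v ϖ = exp (-1 : ℤ)) {m E₁ E₂ : ℕ} (hg : Valued.v g = Valued.v ϖ ^ m) (hm : 1 ≤ m)
    (hE₁ : m < E₁) (hE₂ : m < E₂) (P : K → Prop) :
    ¬ ∃ f : K, P f ∧ Valued.v (f + g) ≤ Valued.v ϖ ^ E₁ ∧ Valued.v (f + g * (2 - g)) ≤ Valued.v ϖ ^ E₂ := by
  obtain ⟨hϖ0, hϖ1⟩ := ne_zero_and_v_lt_one_of_v_eq_exp hϖ
  have hvϖ : 0 < Valued.v ϖ := (Valuation.pos_iff _).2 hϖ0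
  rintro ⟨f, -, h1, h2⟩
  have hg0 : Valued.v g < Valued.v (1 : K) := by
    rw [map_one, hg]; exact pow_lt_one₀ zero_le hϖ1 (by omega)
  have hg1 : Valued.v (g - 1) = 1 := by
    rw [Valuation.map_sub_swap, Valuation.map_sub_eq_of_lt_left _ hg0, map_one]
  have hdist : Valued.v ((f + g) - (f + g * (2 - g))) = Valued.v ϖ ^ m := by
    rw [show (f + g) - (f + g * (2 - g)) = g * (g - 1) by ring, map_mul, hg, hg1, mul_one]
  have hle : Valued.v ((f + g) - (f + g * (2 - g))) ≤ Valued.v ϖ ^ (m + 1) := by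
    refine (Valuation.map_sub _ _ _).trans (max_le (h1.trans ?_) (h2.trans ?_))
    · exact pow_le_pow_right_of_le_one' hϖ1.le (by omega)
    · exact pow_le_pow_right_of_le_one' hϖ1.le (by omega)
  rw [hdist] at hle
  exact absurd hle (not_le.2 (pow_lt_pow_right_of_lt_one₀ hvϖ hϖ1 (by omega)))

end Data

end Summit.HodgeConjecture.HodgeConjecture.Cruxes.H413.F0P3cDyRamLevLabelledRotTokens

end
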